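import Summits.CriticalPhenomena.PercolationContinuityZ3.Theorems.PercNearOneGluingNoHeavyLowerTailKnQuestion8CoefficientwiseDisjointClusters
import Summits.CriticalPhenomena.PercolationContinuityZ3.Theorems.PercNearOneGluingNoHeavyLowerTailDualBHKBlock
import HarnessLib

/-!
# THEOREM APEX: the coefficientwise first rung CW-PA(z) holds for every `z`-apex multigraph (prim-lf-2 gen 26)

Support file (`--supports stmt-CriticalPhenomena-4575`, closed), prover `prim-lf-2` (gen 26).  No definitions, no named facts, no sorries; standard axioms.
Memo `prim-lf-2/CW-REDUCTION-gen26.md` §13.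

* `Coefficientwise.openCluster_union_zEdges_eq`, `Coefficientwise.not_mem_openCluster_union_zEdges_iff` — adding edges at `z` whose other ends avoid
  `C_x(s₀)` does not change `C_x`, and this is exactly when `z` stays outside the red cluster;
* `Coefficientwise.card_compatible_zColourings` — for a CC colouring `s₀` of `E₀ = E − z` the number of colourings of the `z`-edges compatible with the
  wall is `2^{#(z-edges whose other end is unreached)}`, a function of `U = K ∪ K̄` only; `Coefficientwise.compatible_zColourings_eq_empty` — for a
  non-CC colouring there is none;
* `Coefficientwise.cwpa_of_doublyReachable_adj` — general form: it suffices that every vertex doubly reachable from `x` in `H − z` is adjacent to `z`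
  (e.g. `H − z` a forest with `z` attached anywhere);
* `Coefficientwise.cwpa_of_noDoublyReachable` — corollary: no doubly reachable vertex in `H − z` (e.g. a forest) ⇒ CW-PA(z) for any attachment of `z`;
* `Coefficientwise.cwpa_apex` — **THEOREM APEX**: if every vertex (met by an edge) other than `x, z` is joined to `z` by an edge, and no edge joins `x`
  to `z`, then for all monotone `f, g`:  `0 ≤ Σ_{s ⊆ E : z ∉ C_x(s), z ∉ C_x(E∖s)} (f(C_x s) − f(C_x(E∖s)))(g(C_x s) − g(C_x(E∖s)))`.
  (Colour the `z`-edges last and apply THEOREM CC, `cc_sum_nonneg`.)  Examples: `K_n − xz`, cones with apex `z` over arbitrary multigraphs.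
All decidability is classical.
[cite: KozmaNitzan2024, Questions 8–9 (§5.5 p. 36) (context: first rung of the coefficientwise programme for Question 8)]
-/

namespace Summit.CriticalPhenomena.PercolationContinuityZ3.Theorems

open Finset Literature.Probability.Percolation

namespace Coefficientwise

variable {ι V : Type*} (ends : ι → Sym2 V)

open Classical in
/-- Adding to `s₀` a set `t` of edges whose ends other than `z` avoid `C_x(s₀)` (with `z ∉ C_x(s₀)`) does not change the red cluster of `x`.
[cite: KozmaNitzan2024, §5.5 (context only; folklore)] -/
theorem openCluster_union_zEdges_eq {s₀ t : Finset ι} {x z : V} (hz : z ∉ openCluster (ends '' (↑s₀ : Set ι)) x)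
    (hcond : ∀ i ∈ t, ∀ v ∈ ends i, v ≠ z → v ∉ openCluster (ends '' (↑s₀ : Set ι)) x) :
    openCluster (ends '' (↑(s₀ ∪ t) : Set ι)) x = openCluster (ends '' (↑s₀ : Set ι)) x := by
  refine Set.Subset.antisymm ?_ (openCluster_image_mono ends Finset.subset_union_left x)
  intro y hy
  change (openGraph _).Reachable x y at hy
  rw [SimpleGraph.reachable_iff_reflTransGen] at hy
  induction hy with
  | refl => exact mem_openCluster_self _ _
  | @tail a b _ hab ih =>
    rw [openGraph_image_adj] at hab
    obtain ⟨⟨i, hi, he⟩, _⟩ := hab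
    rcases Finset.mem_union.mp hi with hi₀ | hit
    · exact mem_openCluster_of_edge ends hi₀ he ih
    · exfalso
      have haz : a ≠ z := fun h => hz (h ▸ ih)
      exact hcond i hit a (by rw [he]; exact Sym2.mem_mk_left a b) haz ih

open Classical in
/-- With `s₀` avoiding `z` and `t` a set of edges at `z`: `z ∉ C_x(s₀ ∪ t)` iff the non-`z` ends of the `t`-edges avoid `C_x(s₀)`.
[cite: KozmaNitzan2024, §5.5 (context only; folklore)] -/
theorem not_mem_openCluster_union_zEdges_iff {s₀ t : Finset ι} {x z : V} (hs₀ : ∀ i ∈ s₀, z ∉ ends i) (hxz : z ≠ x)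
    (ht : ∀ i ∈ t, z ∈ ends i) :
    z ∉ openCluster (ends '' (↑(s₀ ∪ t) : Set ι)) x ↔ ∀ i ∈ t, ∀ v ∈ ends i, v ≠ z → v ∉ openCluster (ends '' (↑s₀ : Set ι)) x := by
  have hz : z ∉ openCluster (ends '' (↑s₀ : Set ι)) x := not_mem_openCluster_of_forall_not_mem ends hs₀ hxz
  constructor
  · intro h i hit v hv hvz hvK
    apply h
    have hvK' : v ∈ openCluster (ends '' (↑(s₀ ∪ t) : Set ι)) x := openCluster_image_mono ends Finset.subset_union_left x hvK
    have he : ends i = s(v, z) := (Sym2.mem_and_mem_iff hvz).mp ⟨hv, ht i hit⟩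
    exact mem_openCluster_of_edge ends (Finset.mem_union_right _ hit) he hvK'
  · intro h
    rw [openCluster_union_zEdges_eq ends hz h]
    exact hz

open Classical in
/-- Compatible `z`-colourings of a non-CC colouring: none.  If some `y ≠ x` lies in both clusters of `s₀ ⊆ E₀` and `y` is joined to `z` by an edge of
`Ez`, no `t ⊆ Ez` satisfies the wall conditions. [cite: KozmaNitzan2024, §5.5 (context only; folklore)] -/
theorem compatible_zColourings_eq_empty {Ez : Finset ι} {z y : V} (K Kb : Set V) (hyK : y ∈ K) (hyKb : y ∈ Kb) (hyz : y ≠ z)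
    {j : ι} (hj : j ∈ Ez) (hjy : ends j = s(y, z)) :
    (Ez.powerset.filter (fun t => (∀ i ∈ t, ∀ v ∈ ends i, v ≠ z → v ∉ K) ∧ (∀ i ∈ Ez \ t, ∀ v ∈ ends i, v ≠ z → v ∉ Kb))) = ∅ := by
  rw [Finset.filter_eq_empty_iff]
  intro t _ ⟨h1, h2⟩
  have hyj : y ∈ ends j := by rw [hjy]; exact Sym2.mem_mk_left y z
  by_cases hjt : j ∈ t
  · exact h1 j hjt y hyj hyz hyK
  · exact h2 j (Finset.mem_sdiff.mpr ⟨hj, hjt⟩) y hyj hyz hyKb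

open Classical in
/-- Compatible `z`-colourings of a CC colouring.  If `K ∩ K̄ ⊆ {x}`, `z ∉ K ∪ K̄` and no `Ez`-edge has an end equal to `x`, then the `t ⊆ Ez` with
"non-`z` ends of `t` avoid `K`, non-`z` ends of `Ez \ t` avoid `K̄`" are exactly `A ∪ r`, `A` = the edges with an end in `K̄`, `r` ⊆ the edges whose
non-`z` ends avoid `K ∪ K̄`; hence their number is `2^{#free}`. [cite: KozmaNitzan2024, §5.5 (context only; folklore)] -/
theorem card_compatible_zColourings {Ez : Finset ι} {x z : V} (K Kb : Set V) (hCC : ∀ y, y ∈ K → y ∈ Kb → y = x)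
    (hEz : ∀ i ∈ Ez, z ∈ ends i) (hxEz : ∀ i ∈ Ez, x ∉ ends i) :
    ((Ez.powerset.filter (fun t => (∀ i ∈ t, ∀ v ∈ ends i, v ≠ z → v ∉ K) ∧ (∀ i ∈ Ez \ t, ∀ v ∈ ends i, v ≠ z → v ∉ Kb))).card : ℝ) =
      ((Ez.filter (fun i => ∀ v ∈ ends i, v ≠ z → v ∉ K ∪ Kb)).powerset.card : ℝ) := by
  obtain ⟨A, hA⟩ : ∃ A : Finset ι, A = Ez.filter (fun i => ∃ v ∈ ends i, v ≠ z ∧ v ∈ Kb) := ⟨_, rfl⟩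
  obtain ⟨Fr, hFr⟩ : ∃ Fr : Finset ι, Fr = Ez.filter (fun i => ∀ v ∈ ends i, v ≠ z → v ∉ K ∪ Kb) := ⟨_, rfl⟩
  rw [← hFr]
  have hAF : Disjoint A Fr := by
    rw [hA, hFr, Finset.disjoint_filter]
    rintro i - ⟨v, hv, hvz, hvKb⟩ hfree
    exact hfree v hv hvz (Or.inr hvKb)
  -- the set of compatible colourings is the image of `Fr.powerset` under `r ↦ A ∪ r`
  have himage : Ez.powerset.filter (fun t => (∀ i ∈ t, ∀ v ∈ ends i, v ≠ z → v ∉ K) ∧ (∀ i ∈ Ez \ t, ∀ v ∈ ends i, v ≠ z → v ∉ Kb)) =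
      (Fr.powerset).image (fun r => A ∪ r) := by
    ext t
    rw [Finset.mem_filter, Finset.mem_powerset, Finset.mem_image]
    constructor
    · rintro ⟨htE, h1, h2⟩
      refine ⟨t \ A, Finset.mem_powerset.mpr ?_, ?_⟩
      · intro i hi
        rw [Finset.mem_sdiff] at hi
        rw [hFr, Finset.mem_filter]
        refine ⟨htE hi.1, fun v hv hvz hvU => ?_⟩
        rcases hvU with hvK | hvKb
        · exact h1 i hi.1 v hv hvz hvK
        · exact hi.2 (by rw [hA, Finset.mem_filter]; exact ⟨htE hi.1, v, hv, hvz, hvKb⟩)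
      · -- `A ⊆ t`
        have hAt : A ⊆ t := by
          intro i hi
          rw [hA, Finset.mem_filter] at hi
          obtain ⟨hiE, v, hv, hvz, hvKb⟩ := hi
          by_contra hit
          exact h2 i (Finset.mem_sdiff.mpr ⟨hiE, hit⟩) v hv hvz hvKb
        rw [Finset.union_sdiff_of_subset hAt]
    · rintro ⟨r, hr, rfl⟩
      rw [Finset.mem_powerset] at hr
      have hrE : r ⊆ Ez := fun i hi => by have := hr hi; rw [hFr, Finset.mem_filter] at this; exact this.1
      have hAE : A ⊆ Ez := by rw [hA]; exact Finset.filter_subset _ _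
      refine ⟨Finset.union_subset hAE hrE, ?_, ?_⟩
      · intro i hi v hv hvz hvK
        rcases Finset.mem_union.mp hi with hiA | hir
        · rw [hA, Finset.mem_filter] at hiA
          obtain ⟨hiE, v', hv', hv'z, hv'Kb⟩ := hiA
          -- `v` and `v'` are both the non-`z` end of `i`
          have he : ends i = s(v', z) := (Sym2.mem_and_mem_iff hv'z).mp ⟨hv', hEz i hiE⟩
          have hvv' : v = v' := by
            rw [he, Sym2.mem_iff] at hv
            rcases hv with h | h
            · exact h
            · exact absurd h hvz
          subst hvv'
          have hvx : v = x := hCC v hvK hv'Kb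
          subst hvx
          exact hxEz i hiE hv
        · have := hr hir
          rw [hFr, Finset.mem_filter] at this
          exact this.2 v hv hvz (Or.inl hvK)
      · intro i hi v hv hvz hvKb
        rw [Finset.mem_sdiff, Finset.mem_union, not_or] at hi
        exact hi.2.1 (by rw [hA, Finset.mem_filter]; exact ⟨hi.1, v, hv, hvz, hvKb⟩)
  rw [himage, Finset.card_image_of_injOn]
  -- injectivity of `r ↦ A ∪ r` on subsets of `Fr` (disjoint from `A`)
  intro r₁ hr₁ r₂ hr₂ h
  rw [Finset.mem_coe, Finset.mem_powerset] at hr₁ hr₂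
  have key : ∀ r ⊆ Fr, (A ∪ r) \ A = r := fun r hr => by
    rw [Finset.union_sdiff_left, Finset.sdiff_eq_self_iff_disjoint]
    exact (hAF.mono_right hr).symm
  have := congrArg (· \ A) h
  simp only [key r₁ hr₁, key r₂ hr₂] at this
  exact this

open Classical in
/-- **THEOREM APEX, general form** (prim-lf-2 gen 26, memo §13).  Let `E` be a finite edge multiset on `V` with terminals `x ≠ z`, no edge joining
`x` to `z`, such that every vertex `y ≠ x` that some colouring of `E₀ = {edges avoiding z}` joins to `x` in BOTH colours is adjacent to `z`.  Then the
coefficientwise first rung holds: `0 ≤ Σ_{s ⊆ E : z ∉ C_x(s), z ∉ C_x(E \ s)} (f(C_x s) − f(C_x(E \ s)))(g(C_x s) − g(C_x(E \ s)))` for all monotone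
`f, g : Set V → ℝ`.  (Covers: `z` adjacent to every vertex; `H − z` a forest with `z` attached anywhere; generally `z` dominating the vertices 2-edge-connected
to `x` in `H − z`.  `Vf` is any finset containing all ends of edges; decidability classical.)  [cite: KozmaNitzan2024, Questions 8–9 (§5.5 p. 36) (context)] -/
theorem cwpa_of_doublyReachable_adj (E : Finset ι) (x z : V) (hxz : z ≠ x) (Vf : Finset V) (hVf : ∀ i ∈ E, ∀ y ∈ ends i, y ∈ Vf)
    (hxzE : ∀ i ∈ E, x ∈ ends i → z ∉ ends i)
    (hdom : ∀ s₀, s₀ ⊆ E.filter (fun i => z ∉ ends i) → ∀ y, y ∈ openCluster (ends '' (↑s₀ : Set ι)) x →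
      y ∈ openCluster (ends '' (↑(E.filter (fun i => z ∉ ends i) \ s₀) : Set ι)) x → y ≠ x → ∃ j ∈ E, ends j = s(y, z))
    (f g : Set V → ℝ) (hf : Monotone f) (hg : Monotone g) :
    0 ≤ ∑ s ∈ E.powerset.filter (fun s : Finset ι => z ∉ openCluster (ends '' (↑s : Set ι)) x ∧ z ∉ openCluster (ends '' (↑(E \ s) : Set ι)) x),
      (f (openCluster (ends '' (↑s : Set ι)) x) - f (openCluster (ends '' (↑(E \ s) : Set ι)) x)) *
        (g (openCluster (ends '' (↑s : Set ι)) x) - g (openCluster (ends '' (↑(E \ s) : Set ι)) x)) := by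
  -- split the edges into those at `z` and the rest
  obtain ⟨Ez, hEz⟩ : ∃ Ez : Finset ι, Ez = E.filter (fun i => z ∈ ends i) := ⟨_, rfl⟩
  obtain ⟨E₀, hE₀⟩ : ∃ E₀ : Finset ι, E₀ = E.filter (fun i => z ∉ ends i) := ⟨_, rfl⟩
  have hdisj : Disjoint E₀ Ez := by
    rw [hE₀, hEz, Finset.disjoint_filter]; exact fun i _ h => h
  have hEun : E = E₀ ∪ Ez := by
    rw [hE₀, hEz, Finset.union_comm]; exact (Finset.filter_union_filter_not_eq _ E).symm
  have hE₀z : ∀ i ∈ E₀, z ∉ ends i := fun i hi => by rw [hE₀, Finset.mem_filter] at hi; exact hi.2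
  have hEzz : ∀ i ∈ Ez, z ∈ ends i := fun i hi => by rw [hEz, Finset.mem_filter] at hi; exact hi.2
  have hE₀E : E₀ ⊆ E := by rw [hE₀]; exact Finset.filter_subset _ _
  have hEzE : Ez ⊆ E := by rw [hEz]; exact Finset.filter_subset _ _
  have hxEz : ∀ i ∈ Ez, x ∉ ends i := fun i hi hx => hxzE i (hEzE hi) hx (hEzz i hi)
  -- the weight: number of compatible `z`-colourings, a function of `U = K ∪ K̄`
  obtain ⟨w, hw⟩ : ∃ w : Set V → ℝ, w = fun U => ((Ez.filter (fun i => ∀ v ∈ ends i, v ≠ z → v ∉ U)).powerset.card : ℝ) := ⟨_, rfl⟩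
  have hw0 : ∀ U, 0 ≤ w U := fun U => by rw [hw]; exact Nat.cast_nonneg _
  have hcc := cc_sum_nonneg ends E₀ x Vf (fun i hi => hVf i (hE₀E hi)) w hw0 f g hf hg
  refine hcc.trans_eq (Eq.symm ?_)
  -- Step 1: split `s = s₀ ∪ t` and rewrite the wall and the clusters
  rw [Finset.sum_filter, hEun, DualBHK.sum_powerset_union hdisj, Finset.sum_filter]
  refine Finset.sum_congr rfl fun s₀ hs₀ => ?_
  rw [Finset.mem_powerset] at hs₀
  have hs₀z : ∀ i ∈ s₀, z ∉ ends i := fun i hi => hE₀z i (hs₀ hi)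
  have hbz : ∀ i ∈ E₀ \ s₀, z ∉ ends i := fun i hi => hE₀z i (Finset.sdiff_subset hi)
  have hzK : z ∉ openCluster (ends '' (↑s₀ : Set ι)) x := not_mem_openCluster_of_forall_not_mem ends hs₀z hxz
  have hzKb : z ∉ openCluster (ends '' (↑(E₀ \ s₀) : Set ι)) x := not_mem_openCluster_of_forall_not_mem ends hbz hxz
  -- each inner summand: the wall holds iff `t` is compatible, and then the clusters are those of `s₀`
  have hinner : ∀ t ∈ Ez.powerset,
      (if z ∉ openCluster (ends '' (↑(s₀ ∪ t) : Set ι)) x ∧ z ∉ openCluster (ends '' (↑((E₀ ∪ Ez) \ (s₀ ∪ t)) : Set ι)) x then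
        (f (openCluster (ends '' (↑(s₀ ∪ t) : Set ι)) x) - f (openCluster (ends '' (↑((E₀ ∪ Ez) \ (s₀ ∪ t)) : Set ι)) x)) *
          (g (openCluster (ends '' (↑(s₀ ∪ t) : Set ι)) x) - g (openCluster (ends '' (↑((E₀ ∪ Ez) \ (s₀ ∪ t)) : Set ι)) x))
        else 0) =
      if (∀ i ∈ t, ∀ v ∈ ends i, v ≠ z → v ∉ openCluster (ends '' (↑s₀ : Set ι)) x) ∧
          (∀ i ∈ Ez \ t, ∀ v ∈ ends i, v ≠ z → v ∉ openCluster (ends '' (↑(E₀ \ s₀) : Set ι)) x) then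
        (f (openCluster (ends '' (↑s₀ : Set ι)) x) - f (openCluster (ends '' (↑(E₀ \ s₀) : Set ι)) x)) *
          (g (openCluster (ends '' (↑s₀ : Set ι)) x) - g (openCluster (ends '' (↑(E₀ \ s₀) : Set ι)) x))
        else 0 := by
    intro t ht
    rw [Finset.mem_powerset] at ht
    have htz : ∀ i ∈ t, z ∈ ends i := fun i hi => hEzz i (ht hi)
    have hbtz : ∀ i ∈ Ez \ t, z ∈ ends i := fun i hi => hEzz i (Finset.sdiff_subset hi)
    rw [union_sdiff_union_of_subset hdisj hs₀ ht]
    have h1 := not_mem_openCluster_union_zEdges_iff ends hs₀z hxz htz (x := x)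
    have h2 := not_mem_openCluster_union_zEdges_iff ends hbz hxz hbtz (x := x)
    by_cases hc : (∀ i ∈ t, ∀ v ∈ ends i, v ≠ z → v ∉ openCluster (ends '' (↑s₀ : Set ι)) x) ∧
        (∀ i ∈ Ez \ t, ∀ v ∈ ends i, v ≠ z → v ∉ openCluster (ends '' (↑(E₀ \ s₀) : Set ι)) x)
    · rw [if_pos hc, if_pos ⟨h1.mpr hc.1, h2.mpr hc.2⟩, openCluster_union_zEdges_eq ends hzK hc.1, openCluster_union_zEdges_eq ends hzKb hc.2]
    · rw [if_neg hc, if_neg (fun hW => hc ⟨h1.mp hW.1, h2.mp hW.2⟩)]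
  rw [Finset.sum_congr rfl hinner, ← Finset.sum_filter, Finset.sum_const, nsmul_eq_mul]
  -- Step 2: count the compatible colourings
  by_cases hCC : ∀ y, y ∈ openCluster (ends '' (↑s₀ : Set ι)) x → y ∈ openCluster (ends '' (↑(E₀ \ s₀) : Set ι)) x → y = x
  · rw [if_pos hCC, card_compatible_zColourings ends _ _ hCC hEzz hxEz, hw]
  · rw [if_neg hCC]
    obtain ⟨y, hy⟩ := not_forall.mp hCC
    obtain ⟨hyK, hy'⟩ := Classical.not_imp.mp hy
    obtain ⟨hyKb, hyx⟩ := Classical.not_imp.mp hy'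
    have hyz : y ≠ z := fun h => hzK (h ▸ hyK)
    obtain ⟨j, hjE, hjy⟩ := hdom s₀ (hE₀ ▸ hs₀) y hyK (hE₀ ▸ hyKb) hyx
    have hjEz : j ∈ Ez := by rw [hEz, Finset.mem_filter]; exact ⟨hjE, by rw [hjy]; exact Sym2.mem_mk_right y z⟩
    rw [compatible_zColourings_eq_empty ends _ _ hyK hyKb hyz hjEz hjy, Finset.card_empty, Nat.cast_zero, zero_mul]

open Classical in
/-- **THEOREM APEX** (prim-lf-2 gen 26, memo §13).  If no edge joins `x` to `z` and every vertex `v ∉ {x, z}` met by an edge is joined to `z` by an edge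
(e.g. `K_n − xz`, cones with apex `z` over arbitrary multigraphs), the coefficientwise first rung CW-PA(z) holds for all monotone `f, g`.
[cite: KozmaNitzan2024, Questions 8–9 (§5.5 p. 36) (context)] -/
theorem cwpa_apex (E : Finset ι) (x z : V) (hxz : z ≠ x) (Vf : Finset V) (hVf : ∀ i ∈ E, ∀ y ∈ ends i, y ∈ Vf)
    (hxzE : ∀ i ∈ E, x ∈ ends i → z ∉ ends i)
    (hapex : ∀ i ∈ E, ∀ v ∈ ends i, v ≠ x → v ≠ z → ∃ j ∈ E, ends j = s(v, z))
    (f g : Set V → ℝ) (hf : Monotone f) (hg : Monotone g) :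
    0 ≤ ∑ s ∈ E.powerset.filter (fun s : Finset ι => z ∉ openCluster (ends '' (↑s : Set ι)) x ∧ z ∉ openCluster (ends '' (↑(E \ s) : Set ι)) x),
      (f (openCluster (ends '' (↑s : Set ι)) x) - f (openCluster (ends '' (↑(E \ s) : Set ι)) x)) *
        (g (openCluster (ends '' (↑s : Set ι)) x) - g (openCluster (ends '' (↑(E \ s) : Set ι)) x)) := by
  refine cwpa_of_doublyReachable_adj ends E x z hxz Vf hVf hxzE ?_ f g hf hg
  intro s₀ hs₀ y hyK _ hyx
  obtain ⟨i, hi, hyi⟩ := exists_edge_of_mem_openCluster ends hyK hyx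
  have hiE : i ∈ E := (Finset.mem_filter.mp (hs₀ hi)).1
  have hyz : y ≠ z := by
    rintro rfl
    exact (Finset.mem_filter.mp (hs₀ hi)).2 hyi
  exact hapex i hiE y hyi hyx hyz

open Classical in
/-- **COROLLARY (no doubly reachable vertex; e.g. `H − z` a forest).**  If no edge joins `x` to `z` and no colouring of the edges avoiding `z` joins a vertex
`y ≠ x` to `x` in both colours (this holds whenever those edges form a forest), then CW-PA(z) holds for EVERY way of attaching `z`.
[cite: KozmaNitzan2024, Questions 8–9 (§5.5 p. 36) (context)] -/
theorem cwpa_of_noDoublyReachable (E : Finset ι) (x z : V) (hxz : z ≠ x) (Vf : Finset V) (hVf : ∀ i ∈ E, ∀ y ∈ ends i, y ∈ Vf)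
    (hxzE : ∀ i ∈ E, x ∈ ends i → z ∉ ends i)
    (hno : ∀ s₀, s₀ ⊆ E.filter (fun i => z ∉ ends i) → ∀ y, y ∈ openCluster (ends '' (↑s₀ : Set ι)) x →
      y ∈ openCluster (ends '' (↑(E.filter (fun i => z ∉ ends i) \ s₀) : Set ι)) x → y = x)
    (f g : Set V → ℝ) (hf : Monotone f) (hg : Monotone g) :
    0 ≤ ∑ s ∈ E.powerset.filter (fun s : Finset ι => z ∉ openCluster (ends '' (↑s : Set ι)) x ∧ z ∉ openCluster (ends '' (↑(E \ s) : Set ι)) x),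
      (f (openCluster (ends '' (↑s : Set ι)) x) - f (openCluster (ends '' (↑(E \ s) : Set ι)) x)) *
        (g (openCluster (ends '' (↑s : Set ι)) x) - g (openCluster (ends '' (↑(E \ s) : Set ι)) x)) :=
  cwpa_of_doublyReachable_adj ends E x z hxz Vf hVf hxzE (fun s₀ hs₀ y hy hy' hyx => absurd (hno s₀ hs₀ y hy hy') hyx) f g hf hg

end Coefficientwise

end Summit.CriticalPhenomena.PercolationContinuityZ3.Theorems
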